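import Literature.AnabelianGeometry.AbsoluteAnabelian.AbsTopIII.ReconstructionFactsNonVacuity
import Literature.AnabelianGeometry.AbsoluteAnabelian.AbsTopIII.CurveModelSchemaWitnesses
import Literature.AnabelianGeometry.AbsoluteAnabelian.MLFGaloisTypeProofs
import HarnessLib

/-!
# [AbsTopIII] Thm. 1.9 / Cor. 1.10 (iii) relative to a model: INSTANCE FORMS of `Thm_1_9` (FACT-LIST
# F-0399) and `Cor_1_10_iii` (F-0396) at LABELLED TOY CARRIERS — census-visible shapes

S. Mochizuki, *Topics in Absolute Anabelian Geometry III: Global Reconstruction Algorithms*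
[MochizukiAbsTopIII2015] (manuscript pagination, lit key `paper:url-5493eb38cbb7`): Thm. 1.9 p. 37 "there
exists a functorial 'group-theoretic' algorithm for reconstructing the 'NF-portion of the function field'
of `X` from the extension of profinite groups `1 → Δ_X → Π_X → G_k → 1`"; Cor. 1.10 (iii) p. 43 "there
exists a functorial 'group-theoretic' algorithm for reconstructing the function field `K_X` of `X` from
the profinite group `Π_X`" (proof p. 44 l. 35–36; = Scholze–Stix 2018, Thm. 7 / Rmk. 9).

PROOF-ONLY companion (cell abc-iut, block F, seat abc-iut-f-072 gen 13, KEY row «INST59G2»; no `def`,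
no `instance`, no notation, no new named fact) of abc-iut-L4-t1's `Reconstruction.lean` (imported via
`ReconstructionFactsNonVacuity`, never edited).

CONTEXT.  Both rows are NAMED FACTS RELATIVE TO A MODEL `M : CurveModel` ("SOME functorial
group-theoretic algorithm record has the printed output on every input curve of the model").  Their
universal closures are REFUTED in the tree (abc-iut-f-088 `not_forall_thm_1_9`, `not_forall_cor_1_10_iii`:
two curves with the same extension and different point data / NF-function fields defeat every algorithm),
and abc-iut-f-056's joint witness `exists_reconstructionFacts_nonVacuous` (p434040) proved both rows at a
one-curve interface over `ℚ_p` — but in a shape (`∃ M hclosed, (∃ X, M.IsThm19Input X ∧ …) ∧ Thm_1_9 M ∧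
…`) whose FIRST decl-headed conjunct is the vocabulary row `IsThm19Input`, so the kernel census credits
neither F-0399 nor F-0396 with an instance.  This file supplies census-visible shapes:

* `cor_1_10_iii_toyModel k H` — **F-0396 at the NAMED toy interface** `CurveModelSchemaWitness.toyModel k
  H` of abc-iut-f-076 (one curve over `k`, `Π := G_k × H ↠ G_k` for ANY profinite `H`, so `Δ = {1} × H`
  is NON-TRIVIAL; one closed point with `D = 1`; `K_X := k`; strictly-Belyi flag `True`), by the CONSTANT
  algorithm record `E ↦ (k ⊆ k, closed-point set {1})`; `_padic`: at `k = ℚ_p` the input class fires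
  (`isMLF_padic`), displayed;
* `not_thm_1_9_toyModel_rat H` — the SAME named interface CANNOT carry Thm. 1.9 at `k = ℚ` (nor can any
  interface with "`K_{Z_NF} := k`" over a sub-`p`-adic `k`): clause (e) asks for fields
  `k̄_NF ≅ constField → functionField ≅ K_{Z_NF} = ℚ`, i.e. a ring homomorphism `ℚ̄ → ℚ`, and `-1` is a
  square in `ℚ̄`.  (A typing artefact of the junk field `NFFunctionField := k` — print's `K_{Z_NF}`
  contains `k̄_NF` —, recorded so that nobody looks for the instance there.)
* `Thm_1_9.exists_toyCarrier p` — **F-0399 as the HEAD conjunct of a `∃`-witness**, re-packaged from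
  abc-iut-f-056's interface over `ℚ_p` (`Π = G_{ℚ_p}`, `Δ = 1`, one NF-flagged point with `D = Π`,
  `K_{Z_NF} := ` the algebraic closure of `ℚ` in `ℚ̄_p`, constant algorithm record), with the input class
  displayed firing; `Cor_1_10_iii.exists_toyCarrier p` likewise for F-0396.

HONEST LABEL — DEGENERATE / CONSTANT: the algorithm records ignore their input and have no anabelian
content; at a one-curve interface the comparison clause cannot see functoriality; toy carriers, not models
of any curve.  The printed content (Belyi cuspidalization, Kummer classes, Uchida's lemma, [pGC]) stays a
named input at the intended étale-`π₁` instance.  Refereed pre-IUT material typed statements-first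
(D-0014); typed ≠ proved; an instance-form theorem about OUR typed statement ≠ a theorem about [AbsTopIII]
in print; nothing here bears on [IUTchIII] Cor. 3.12 or takes a side; axioms standard.
-/

noncomputable section

open CategoryTheory
open scoped Pointwise

namespace Literature.AnabelianGeometry.AbsoluteAnabelian.AbsTopIII

open CurveModelSchemaWitness

/-! ### F-0396 at the named toy interface `Π = G_k × H` (any profinite `H`) -/

/-- **F-0396 `Cor_1_10_iii` — INSTANCE FORM at the NAMED toy interface `toyModel k H`** (one curve over
`k`, `Π := G_k × H ↠ G_k` with `Δ = {1} × H` for ANY profinite group `H`, one closed point with `D = 1`,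
`K_X := k`, strictly-Belyi flag `True`): the CONSTANT algorithm record sending every extension to the
output "`k ⊆ k`, closed-point decomposition groups `{1}`, cyclotomes `ℤ`, trivial Frobenius character,
Kummer container `k^×` with the identity Kummer map" meets both comparison clauses (iii)(h) and (iii)(e)
at the single curve.  HONEST LABEL: toy carrier / constant record, no anabelian content.
[cite: MochizukiAbsTopIII2015, Cor 1.10 (iii) p.43] -/
theorem cor_1_10_iii_toyModel (k : Type) [Field k] [CharZero k] (H : ProfiniteGrp.{0}) :
    Cor_1_10_iii (toyModel k H) := by
  classical
  let A : MLFReconstructionAlgorithm.{0} :=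
    { obj := fun E =>
        { galCyclotome := ℤ
          arithCyclotome := ℤ
          cycloSync := AddEquiv.refl ℤ
          frobQuot := 1
          H1 := kˣ
          baseField := k
          kummerBase := MonoidHom.id _
          kummerBase_injective := fun _ _ h => h
          functionField := k
          closedPointDecomp := {⊥} }
      map := fun _ => ⟨RingEquiv.refl _, RingEquiv.refl _, fun _ => rfl⟩
      map_id := fun _ => rfl
      map_comp := fun _ _ => rfl
      comap := fun _ _ => RingHom.id _
      comap_map := fun _ _ _ => rfl }
  refine ⟨A, fun X _ _ => ⟨⟨RingEquiv.refl _, RingEquiv.refl _, fun _ => rfl⟩, ?_⟩⟩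
  have hbot : ∀ g : (toyExt k H).arith, MulAut.conj g • (⊥ : Subgroup (toyExt k H).arith) = ⊥ :=
    fun g => Subgroup.smul_bot _
  show ({⊥} : Set (Subgroup (toyExt k H).arith)) =
    {D | ∃ (x : PUnit) (g : (toyExt k H).arith), D = MulAut.conj g • (⊥ : Subgroup (toyExt k H).arith)}
  ext D
  simp only [Set.mem_singleton_iff, Set.mem_setOf_eq, hbot]
  exact ⟨fun h => ⟨PUnit.unit, 1, h⟩, fun ⟨_, _, h⟩ => h⟩

/-- **F-0396 at the named toy interface over the MLF `ℚ_p`, input class displayed firing**: `Cor_1_10_iii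
(toyModel ℚ_p H)` holds AND the interface has a curve that is a Cor-1.10 input (`ℚ_p` is an MLF,
`isMLF_padic`) of strictly Belyi flag with a closed point — every binder of the row fires.  HONEST LABEL:
toy carrier / constant record. [cite: MochizukiAbsTopIII2015, Cor 1.10 (iii) p.43] -/
theorem cor_1_10_iii_toyModel_padic (p : ℕ) [Fact p.Prime] (H : ProfiniteGrp.{0}) :
    Cor_1_10_iii (toyModel ℚ_[p] H) ∧
      ∃ X : (toyModel ℚ_[p] H).Curve, (toyModel ℚ_[p] H).IsCor110Input X ∧
        (toyModel ℚ_[p] H).IsStrictlyBelyiType X ∧ Nonempty ((toyModel ℚ_[p] H).Point X) :=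
  ⟨cor_1_10_iii_toyModel ℚ_[p] H, PUnit.unit, isMLF_padic p, trivial, ⟨PUnit.unit⟩⟩

/-! ### F-0399: the named toy interface cannot carry Thm. 1.9 over `ℚ` -/

/-- **The named toy interface over `ℚ` does NOT satisfy `Thm_1_9`** (any `H`): its junk field
"`K_{Z_NF} := ℚ`" admits no ring homomorphism from `k̄_NF = ℚ̄` (the image of `√-1` would square to `-1`
in `ℚ`), while clause (e) of the row provides `k̄_NF ≅ constField → functionField ≅ K_{Z_NF}` at the
Thm-1.9 input curve (`ℚ` is sub-`p`-adic, `IsSubpadic.of_isNF`).  A statement about OUR junk interface,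
not about print (where `k̄_NF ⊆ K_{Z_NF}`). [cite: MochizukiAbsTopIII2015, Thm 1.9 (e) p.38] -/
theorem not_thm_1_9_toyModel_rat (H : ProfiniteGrp.{0}) : ¬ Thm_1_9 (toyModel ℚ H) := by
  rintro ⟨A, hA⟩
  obtain ⟨-, ⟨ec⟩, ⟨ef⟩⟩ := hA PUnit.unit ⟨trivial, IsSubpadic.of_isNF ⟨inferInstance⟩⟩
  -- the composite ring homomorphism `k̄_NF → constField → functionField → K_{Z_NF} = ℚ`
  let φ : (toyModel ℚ H).kbarNF PUnit.unit →+* ℚ :=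
    ef.toRingHom.comp ((algebraMap _ _).comp ec.symm.toRingHom)
  -- `√-1 ∈ k̄_NF`
  obtain ⟨z, hz⟩ := IsAlgClosed.exists_eq_mul_self (-1 : AlgebraicClosure ℚ)
  have halg : Algebra.IsAlgebraic ℚ (AlgebraicClosure ℚ) := AlgebraicClosure.isAlgebraic ℚ
  have hzmem : z ∈ (toyModel ℚ H).kbarNF PUnit.unit := by
    unfold CurveModel.kbarNF
    rw [mem_algebraicClosure_iff]
    convert halg.isAlgebraic z
  have h1 : φ ⟨z, hzmem⟩ * φ ⟨z, hzmem⟩ = -1 := by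
    rw [← map_mul, ← map_one φ, ← map_neg]
    congr 1
    exact Subtype.ext hz.symm
  have h2 : (0 : ℚ) ≤ φ ⟨z, hzmem⟩ * φ ⟨z, hzmem⟩ := mul_self_nonneg _
  linarith

/-! ### F-0399 / F-0396 as head conjuncts of `∃`-witnesses (abc-iut-f-056's carrier over `ℚ_p`) -/

/-- **F-0399 `Thm_1_9` — `∃`-WITNESS with the row as HEAD conjunct**, input class displayed firing: for
every prime `p` there is an interface (abc-iut-f-056's: one curve over `ℚ_p`, `Π = G_{ℚ_p}`, `Δ = 1`,
one NF-flagged closed point with `D = Π`, `K_{Z_NF} := ` the algebraic closure of `ℚ` in `ℚ̄_p`; CONSTANT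
algorithm record) at which `Thm_1_9` holds and which has a Thm-1.9 input curve (strictly-Belyi flag, base
`ℚ_p` sub-`p`-adic) with an NF-point — every binder of the row fires.  HONEST LABEL: DEGENERATE /
CONSTANT (no anabelian content). [cite: MochizukiAbsTopIII2015, Thm 1.9 p.37] -/
theorem Thm_1_9.exists_toyCarrier (p : ℕ) [Fact p.Prime] :
    ∃ M : CurveModel.{0}, Thm_1_9 M ∧
      (∃ X : M.Curve, M.IsThm19Input X ∧ M.IsStrictlyBelyiType X ∧ Nonempty (M.Point X) ∧
        ∀ x : M.Point X, M.IsNFPoint X x) ∧ Cor_1_10_iii M ∧ M.Rmk_1_9_2 := by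
  obtain ⟨M, -, ⟨X, h19, -, hB, -, -, hne, hnf, -⟩, h9, h10, -, -, -, hR, -⟩ :=
    exists_reconstructionFacts_nonVacuous p
  exact ⟨M, h9, ⟨X, h19, hB, hne, hnf⟩, h10, hR⟩

/-- **F-0399 — closed form at `p = 2`** (no binders). HONEST LABEL: DEGENERATE / CONSTANT.
[cite: MochizukiAbsTopIII2015, Thm 1.9 p.37] -/
theorem Thm_1_9.exists_toyCarrier_two :
    ∃ M : CurveModel.{0}, Thm_1_9 M ∧
      (∃ X : M.Curve, M.IsThm19Input X ∧ M.IsStrictlyBelyiType X ∧ Nonempty (M.Point X) ∧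
        ∀ x : M.Point X, M.IsNFPoint X x) ∧ Cor_1_10_iii M ∧ M.Rmk_1_9_2 :=
  haveI : Fact (Nat.Prime 2) := ⟨Nat.prime_two⟩
  Thm_1_9.exists_toyCarrier 2

/-- **F-0396 `Cor_1_10_iii` — `∃`-WITNESS with the row as HEAD conjunct**, input class displayed firing
(abc-iut-f-056's carrier over `ℚ_p`: the curve is a Cor-1.10 input, `ℚ_p` an MLF, of strictly Belyi
flag, with a closed point).  HONEST LABEL: DEGENERATE / CONSTANT. [cite: MochizukiAbsTopIII2015, Cor 1.10 (iii) p.43] -/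
theorem Cor_1_10_iii.exists_toyCarrier (p : ℕ) [Fact p.Prime] :
    ∃ M : CurveModel.{0}, Cor_1_10_iii M ∧
      (∃ X : M.Curve, M.IsCor110Input X ∧ M.IsStrictlyBelyiType X ∧ Nonempty (M.Point X)) ∧
        Thm_1_9 M := by
  obtain ⟨M, -, ⟨X, -, h110, hB, -, -, hne, -, -⟩, h9, h10, -⟩ :=
    exists_reconstructionFacts_nonVacuous p
  exact ⟨M, h10, ⟨X, h110, hB, hne⟩, h9⟩

end Literature.AnabelianGeometry.AbsoluteAnabelian.AbsTopIII
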